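import Summits.RiemannHypothesis.RiemannHypothesis.Theorems.SemilocalListPoly
import Literature.Analysis.ValidatedNumerics.MultiPrecisionInterval
import Mathlib.Analysis.SpecialFunctions.Integrals.Basic
import Mathlib.MeasureTheory.Integral.Bochner.Set
import HarnessLib

/-!
# Band energy of time-limited functions, III: list-polynomial bookkeeping and interval evaluation at `π`

Cell `rh-explicit`, seat cc-s2-3 (`HOME/cc-s2-3/CERT-PLAN.md` §7, sub-task E1).  Third of four files proving
`∫_{-1}^{1} |𝓕 f(ξ)|² dξ ≤ 0.9999428 · ‖f‖²` for `f ∈ L²(ℝ)` vanishing off `[−1, 1]`.  Pure bookkeeping on the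
kernel-computable rational coefficient lists `LQ` of `Theorems/SemilocalListPoly` (seat cc-s2-4) and on the
fixed-point interval engine `NumericsMP.MI` of `Literature/Analysis/ValidatedNumerics` — no Fourier analysis:

* `momQ l k = ∫_{[−1,1]} x^k l(x) dx ∈ ℚ` (`setIntegral_pow_mul_ev`, and its complex form);
* the Taylor main term of `∫_{[−1,1]} e^{−2πixξ} l(x) dx`, namely `Σ_{k<n} ((−2πiξ)^k/k!) momQ l k`, equals
  `C(πξ) − i S(πξ)` for the explicit rational lists `cList l n`, `sList l n` (`taylorSum_eq_cList_sList`);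
* products: `conj(C_j − iS_j)(C_k − iS_k) = R_{jk} + i J_{jk}` with `R = C_jC_k + S_jS_k`, `J = S_jC_k − C_jS_k`
  (`conj_mul_eq_reList_imList`);
* `∫_{−1}^{1} l(πξ) dξ = (yT l)(π)` (`integral_ev_pi_mul`), so every matrix entry of file IV is `ev (…) π`;
* `scaleList` (`ev (scaleList l 4) (π/4) = ev l π`: interval Horner must run at a point of modulus `< 1`);
* `hornerMI` — Horner evaluation of a rational list in `MI` interval arithmetic, with its inclusion theorem
  (`mem_hornerMI`), to be fed the engine's own enclosure `MI.pi` of `π`.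

All `def`s are computable over `ℚ`/`ℤ` (certificate checks in file IV are `decide +kernel`).  No facts, no axioms.
-/

set_option linter.dupNamespace false  -- the mandated namespace repeats `RiemannHypothesis`

noncomputable section

open MeasureTheory Complex Set Finset
open scoped Real ComplexConjugate
open Summit.RiemannHypothesis.RiemannHypothesis.Theorems.SemilocalPolyWitness
open Literature.Analysis.ValidatedNumerics.NumericsMP

namespace Summit.RiemannHypothesis.RiemannHypothesis.BandEnergy

/-! ## Moments `∫_{[−1,1]} x^k l(x) dx` -/

/-- The monomial `x^k` as a coefficient list. [folklore] -/
def monomialL (k : ℕ) : List ℚ := List.replicate k 0 ++ [1]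

/-- `ev (monomialL k) x = x^k`. [folklore] -/
theorem ev_monomialL : ∀ (k : ℕ) (x : ℝ), LQ.ev (monomialL k) x = x ^ k
  | 0, x => by simp [monomialL]
  | k + 1, x => by
      have h : monomialL (k + 1) = 0 :: monomialL k := by simp [monomialL, List.replicate_succ]
      rw [h, LQ.ev_cons, ev_monomialL k x]; push_cast; ring

/-- The `k`-th moment `∫_{−1}^{1} x^k l(x) dx` of a list polynomial, a rational number (kernel-computable).
[folklore] -/
def momQ (l : List ℚ) (k : ℕ) : ℚ :=
  LQ.evQ (LQ.integ (LQ.mul (monomialL k) l)) 1 - LQ.evQ (LQ.integ (LQ.mul (monomialL k) l)) (-1)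

/-- `∫_{−1}^{1} x^k l(x) dx = momQ l k` (interval integral). [folklore] -/
theorem intervalIntegral_pow_mul_ev (l : List ℚ) (k : ℕ) :
    ∫ x in (-1 : ℝ)..1, x ^ k * LQ.ev l x = (momQ l k : ℝ) := by
  have h : (fun x : ℝ => x ^ k * LQ.ev l x) = fun x => LQ.ev (LQ.mul (monomialL k) l) x := by
    funext x; rw [LQ.ev_mul, ev_monomialL]
  rw [h, LQ.integral_ev, momQ]
  have e1 : LQ.ev (LQ.integ (LQ.mul (monomialL k) l)) 1 = ((LQ.evQ (LQ.integ (LQ.mul (monomialL k) l)) 1 : ℚ) : ℝ) := by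
    rw [← LQ.ev_ratCast]; norm_num
  have e2 : LQ.ev (LQ.integ (LQ.mul (monomialL k) l)) (-1)
      = ((LQ.evQ (LQ.integ (LQ.mul (monomialL k) l)) (-1) : ℚ) : ℝ) := by
    rw [← LQ.ev_ratCast]; norm_num
  rw [e1, e2]; push_cast; ring

/-- `∫_{[−1,1]} x^k l(x) dx = momQ l k` (set integral). [folklore] -/
theorem setIntegral_pow_mul_ev (l : List ℚ) (k : ℕ) :
    ∫ x in Icc (-1 : ℝ) 1, x ^ k * LQ.ev l x = (momQ l k : ℝ) := by
  rw [integral_Icc_eq_integral_Ioc, ← intervalIntegral.integral_of_le (by norm_num : (-1 : ℝ) ≤ 1)]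
  exact intervalIntegral_pow_mul_ev l k

/-- Complex form: `∫_{[−1,1]} x^k l(x) dx = momQ l k` with the integrand read in `ℂ`. [folklore] -/
theorem setIntegral_pow_mul_ev_complex (l : List ℚ) (k : ℕ) :
    ∫ x in Icc (-1 : ℝ) 1, (x : ℂ) ^ k * (LQ.ev l x : ℂ) = ((momQ l k : ℝ) : ℂ) := by
  have h : (fun x : ℝ => (x : ℂ) ^ k * (LQ.ev l x : ℂ)) = fun x : ℝ => ((x ^ k * LQ.ev l x : ℝ) : ℂ) := by
    funext x; push_cast; ring
  rw [h, integral_complex_ofReal, setIntegral_pow_mul_ev]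

/-- `∫_{[−1,1]} |l| ≤ 2 · absBound l 1`. [folklore] -/
theorem setIntegral_norm_ev_le (l : List ℚ) :
    ∫ x in Icc (-1 : ℝ) 1, ‖(LQ.ev l x : ℂ)‖ ≤ 2 * (LQ.absBound l 1 : ℝ) := by
  have hb : ∀ x ∈ Icc (-1 : ℝ) 1, ‖(LQ.ev l x : ℂ)‖ ≤ (LQ.absBound l 1 : ℝ) := fun x hx => by
    rw [Complex.norm_real, Real.norm_eq_abs]
    have : |x| ≤ ((1 : ℚ) : ℝ) := by push_cast; exact abs_le.2 ⟨by linarith [hx.1], hx.2⟩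
    exact LQ.abs_ev_le_absBound l this
  calc ∫ x in Icc (-1 : ℝ) 1, ‖(LQ.ev l x : ℂ)‖ ≤ ∫ x in Icc (-1 : ℝ) 1, (LQ.absBound l 1 : ℝ) := by
        refine setIntegral_mono_on ?_ (by simp) measurableSet_Icc hb
        exact Continuous.integrableOn_Icc (by have := LQ.continuous_ev l; fun_prop)
    _ = 2 * (LQ.absBound l 1 : ℝ) := by
        rw [setIntegral_const, smul_eq_mul, Measure.real, Real.volume_Icc]; norm_num

/-! ## The Taylor main term as two real polynomials in `y = πξ` -/

/-- Coefficients of `C(y) = Σ_{k even, k<n} (−1)^{k/2} 2^k (momQ l k / k!) y^k` (cosine part). [folklore] -/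
def cList (l : List ℚ) (n : ℕ) : List ℚ :=
  (List.range n).map fun k => if k % 2 = 0 then (-1) ^ (k / 2) * 2 ^ k * momQ l k / k.factorial else 0

/-- Coefficients of `S(y) = Σ_{k odd, k<n} (−1)^{(k−1)/2} 2^k (momQ l k / k!) y^k` (sine part). [folklore] -/
def sList (l : List ℚ) (n : ℕ) : List ℚ :=
  (List.range n).map fun k => if k % 2 = 0 then 0 else (-1) ^ (k / 2) * 2 ^ k * momQ l k / k.factorial

/-- Entries of a mapped range. [folklore] -/
theorem getD_map_range {n : ℕ} (f : ℕ → ℚ) {k : ℕ} (hk : k < n) :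
    ((List.range n).map f).getD k 0 = f k := by
  rw [List.getD_eq_getElem?_getD, List.getElem?_map, List.getElem?_range hk]
  rfl

/-- `(−2wi)^{2j} = (−1)^j 2^{2j} w^{2j}`. [folklore] -/
theorem neg_two_mul_I_pow_even (w : ℂ) (j : ℕ) :
    (-2 * w * I) ^ (2 * j) = (-1) ^ j * (2 ^ (2 * j) * w ^ (2 * j)) := by
  have h2 : (-2 * w * I) ^ 2 = (-1) * (2 ^ 2 * w ^ 2) := by
    have := Complex.I_sq; linear_combination (4 * w ^ 2) * this
  rw [pow_mul, h2, mul_pow, mul_pow, ← pow_mul, ← pow_mul]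

/-- `(−2wi)^{2j+1} = −i (−1)^j 2^{2j+1} w^{2j+1}`. [folklore] -/
theorem neg_two_mul_I_pow_odd (w : ℂ) (j : ℕ) :
    (-2 * w * I) ^ (2 * j + 1) = -I * ((-1) ^ j * (2 ^ (2 * j + 1) * w ^ (2 * j + 1))) := by
  rw [pow_succ, neg_two_mul_I_pow_even, pow_succ, pow_succ]; ring

/-- Length of `cList`. [folklore] -/
@[simp] theorem length_cList (l : List ℚ) (n : ℕ) : (cList l n).length = n := by simp [cList]

/-- Length of `sList`. [folklore] -/
@[simp] theorem length_sList (l : List ℚ) (n : ℕ) : (sList l n).length = n := by simp [sList]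

/-- **The Taylor main term is `C(πξ) − i S(πξ)`.** [folklore] -/
theorem taylorSum_eq_cList_sList (l : List ℚ) (n : ℕ) (ξ : ℝ) :
    ∑ k ∈ range n, (↑(-2 * π * ξ) * I) ^ k / (k.factorial : ℂ) * ((momQ l k : ℝ) : ℂ)
      = (LQ.ev (cList l n) (π * ξ) : ℂ) - I * (LQ.ev (sList l n) (π * ξ) : ℂ) := by
  have hw : ∀ k : ℕ, ((↑(-2 * π * ξ) * I : ℂ)) ^ k = (-2 * ((π : ℂ) * (ξ : ℂ)) * I) ^ k := fun k => by
    push_cast; ring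
  simp_rw [hw]
  rw [LQ.ev_eq_sum, LQ.ev_eq_sum, length_cList, length_sList]
  push_cast
  rw [Finset.mul_sum, ← Finset.sum_sub_distrib]
  refine Finset.sum_congr rfl fun k hk => ?_
  have hk' := Finset.mem_range.1 hk
  rw [cList, sList, getD_map_range _ hk', getD_map_range _ hk']
  obtain ⟨j, rfl | rfl⟩ := Nat.even_or_odd' k
  · have h1 : (2 * j) % 2 = 0 := by omega
    have h2 : (2 * j) / 2 = j := by omega
    simp only [h1, h2, if_true]
    push_cast
    rw [neg_two_mul_I_pow_even]
    ring
  · have h1 : (2 * j + 1) % 2 = 1 := by omega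
    have h2 : (2 * j + 1) / 2 = j := by omega
    simp only [h1, h2, one_ne_zero, if_false]
    push_cast
    rw [neg_two_mul_I_pow_odd]
    ring

/-! ## Products of main terms: real and imaginary coefficient lists -/

/-- Real part list of `conj(C_j − iS_j)(C_k − iS_k)`: `C_jC_k + S_jS_k`. [folklore] -/
def reList (cj sj ck sk : List ℚ) : List ℚ := LQ.add (LQ.mul cj ck) (LQ.mul sj sk)

/-- Imaginary part list of `conj(C_j − iS_j)(C_k − iS_k)`: `S_jC_k − C_jS_k`. [folklore] -/
def imList (cj sj ck sk : List ℚ) : List ℚ := LQ.add (LQ.mul sj ck) (LQ.neg (LQ.mul cj sk))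

/-- `conj(C_j − iS_j) · (C_k − iS_k) = R + iJ` with the lists `reList`, `imList`. [folklore] -/
theorem conj_mul_eq_reList_imList (cj sj ck sk : List ℚ) (y : ℝ) :
    conj ((LQ.ev cj y : ℂ) - I * (LQ.ev sj y : ℂ)) * ((LQ.ev ck y : ℂ) - I * (LQ.ev sk y : ℂ))
      = (LQ.ev (reList cj sj ck sk) y : ℂ) + I * (LQ.ev (imList cj sj ck sk) y : ℂ) := by
  rw [reList, imList, LQ.ev_add, LQ.ev_mul, LQ.ev_mul, LQ.ev_add, LQ.ev_mul, LQ.ev_neg, LQ.ev_mul]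
  simp only [map_sub, map_mul, Complex.conj_ofReal, Complex.conj_I]
  push_cast
  have hI2 : I ^ 2 = -1 := Complex.I_sq
  linear_combination (-(↑(LQ.ev sj y) : ℂ) * ↑(LQ.ev sk y)) * hI2

/-! ## `∫_{−1}^{1} l(πξ) dξ` as a polynomial in `π` -/

/-- The list `yT l` with `(yT l)_k = l_k (1 − (−1)^{k+1})/(k+1)`, so that `∫_{−1}^{1} l(πξ) dξ = (yT l)(π)`.
[folklore] -/
def yT (l : List ℚ) : List ℚ :=
  (List.range l.length).map fun k => l.getD k 0 * ((1 - (-1) ^ (k + 1)) / (k + 1))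

/-- Length of `yT`. [folklore] -/
@[simp] theorem length_yT (l : List ℚ) : (yT l).length = l.length := by simp [yT]

/-- **Termwise integration**: `∫_{−1}^{1} l(πξ) dξ = ev (yT l) π`. [folklore] -/
theorem integral_ev_pi_mul (l : List ℚ) : ∫ ξ in (-1 : ℝ)..1, LQ.ev l (π * ξ) = LQ.ev (yT l) π := by
  have e : (fun ξ : ℝ => LQ.ev l (π * ξ)) = fun ξ => ∑ j ∈ range l.length, (((l.getD j 0 : ℚ) : ℝ) * π ^ j) * ξ ^ j := by
    funext ξ; rw [LQ.ev_eq_sum]; exact Finset.sum_congr rfl fun j _ => by rw [mul_pow]; ring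
  rw [e, intervalIntegral.integral_finsetSum (fun j _ => by
      exact ((continuous_const).mul (continuous_pow j)).intervalIntegrable _ _)]
  simp_rw [intervalIntegral.integral_const_mul, integral_pow]
  rw [LQ.ev_eq_sum, length_yT]
  refine Finset.sum_congr rfl fun j hj => ?_
  rw [yT, getD_map_range _ (Finset.mem_range.1 hj)]
  push_cast
  ring

/-- Set-integral form: `∫_{[−1,1]} l(πξ) dξ = ev (yT l) π`. [folklore] -/
theorem setIntegral_ev_pi_mul (l : List ℚ) : ∫ ξ in Icc (-1 : ℝ) 1, LQ.ev l (π * ξ) = LQ.ev (yT l) π := by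
  rw [integral_Icc_eq_integral_Ioc, ← intervalIntegral.integral_of_le (by norm_num : (-1 : ℝ) ≤ 1)]
  exact integral_ev_pi_mul l

/-- Rescaled coefficient list `l_k ↦ l_k c^k`, so that `ev (scaleList l c) y = ev l (c·y)`; used with `c = 4`,
`y = π/4` to keep interval Horner evaluation contracting (`|y| < 1`). [folklore] -/
def scaleList (l : List ℚ) (c : ℚ) : List ℚ := (List.range l.length).map fun k => l.getD k 0 * c ^ k

/-- Length of `scaleList`. [folklore] -/
@[simp] theorem length_scaleList (l : List ℚ) (c : ℚ) : (scaleList l c).length = l.length := by simp [scaleList]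

/-- `ev (scaleList l c) y = ev l (c·y)`. [folklore] -/
theorem ev_scaleList (l : List ℚ) (c : ℚ) (y : ℝ) : LQ.ev (scaleList l c) y = LQ.ev l ((c : ℝ) * y) := by
  rw [LQ.ev_eq_sum, LQ.ev_eq_sum, length_scaleList]
  refine Finset.sum_congr rfl fun k hk => ?_
  rw [scaleList, getD_map_range _ (Finset.mem_range.1 hk)]
  push_cast
  rw [mul_pow]
  ring

/-! ## Horner evaluation in the interval engine `MI` -/

/-- Horner evaluation of a rational coefficient list at an `MI` interval (scale `S`). [folklore] -/
def hornerMI (S : ℕ) : List ℚ → MI → MI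
  | [], _ => MI.ofInt S 0
  | c :: l, X => (MI.ofFrac S c.num c.den).add (MI.mul S X (hornerMI S l X))

/-- **Inclusion theorem for `hornerMI`**: if `x ∈ X` then `ev l x ∈ hornerMI S l X`. [folklore] -/
theorem mem_hornerMI {S : ℕ} (hS : 0 < S) {x : ℝ} {X : MI} (hx : MI.mem S x X) :
    ∀ l : List ℚ, MI.mem S (LQ.ev l x) (hornerMI S l X)
  | [] => by simpa [hornerMI] using MI.mem_ofInt S 0
  | c :: l => by
      rw [LQ.ev_cons, hornerMI]
      have hc : MI.mem S ((c : ℚ) : ℝ) (MI.ofFrac S c.num c.den) := by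
        have h := MI.mem_ofFrac S c.num (q := c.den) c.pos
        convert h using 1
        rw [Rat.cast_def]
      exact MI.mem_add hc (MI.mem_mul hS hx (mem_hornerMI hS hx l))

/-- Lower endpoint read-out: `x ∈ X ⇒ X.lo / S ≤ x`. [folklore] -/
theorem lo_le_of_mem_hornerMI {S : ℕ} (hS : 0 < S) {x : ℝ} {X : MI} (hx : MI.mem S x X) (l : List ℚ) :
    ((hornerMI S l X).lo : ℝ) / S ≤ LQ.ev l x :=
  MI.lo_div_le hS (mem_hornerMI hS hx l)

/-- Upper endpoint read-out: `x ∈ X ⇒ x ≤ X.hi / S`. [folklore] -/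
theorem le_hi_of_mem_hornerMI {S : ℕ} (hS : 0 < S) {x : ℝ} {X : MI} (hx : MI.mem S x X) (l : List ℚ) :
    LQ.ev l x ≤ ((hornerMI S l X).hi : ℝ) / S :=
  MI.le_hi_div hS (mem_hornerMI hS hx l)

end Summit.RiemannHypothesis.RiemannHypothesis.BandEnergy
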